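import Mathlib
import Summits.CriticalPhenomena.SAWScalingLimit.Theses.SAWDefectDecoherence
import Summits.CriticalPhenomena.SAWScalingLimit.Theorems.SAWDefectDecoherenceDefectDecoherenceMacroRecursion
import HarnessLib

/-!
# Reduction of the crux `SAWDefectDecoherence.DefectDecoherence` to two scale-local exponent statements
(line `tip-martingale-depth-induction`, stmt-CriticalPhenomena-8549; lead prover; vocabulary
`…/Theorems/SAWDefectDecoherenceTipMartingaleDefs.lean`, recursion `…MacroRecursion.lean`)

`defectDecoherence_of_orbitMixingMacro_of_wallExit`: the crux follows from
* **S1' (macroscopic orbit mixing)** `∃ cα α, 3/4 < α ∧ 0 ≤ cα ∧ ∀ m₀ ≥ 1, ∃ smin,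
  MixingBoundOn (cα m^{-α}) m₀ smin` — the orbit-averaged contraction of the `13/8`-character of the
  lifted entrance law, given the exact near picture, decays like `(R/s)^{-α}` for ratios `≤ m₀` at
  scales `≥ smin(m₀)`; and
* **S2 (wall exit)** `∃ c β, 3/4 < β ∧ 0 ≤ c ∧ ExitBound c β` — the positive-mass tail of walks
  from a root next to `B(v,ρ)` that reach distance `L` before ending in `star(v)` is
  `≤ c (L/ρ)^{-β}`,
both OPEN (no rigorous winding-decoherence or arm-exponent rate for critical planar SAW exists; S2
moreover implies finiteness of the critical two-point function of the slit plane,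
`Theorems/DefectDecoherence/Negative/WallExitTwoPoint.lean`).  Everything else of the line is
proved: the crude bound `‖T‖ ≤ M/2` (here), the telescoped first-entrance recursion S3'
and the dyadic scale induction S4' (`…MacroRecursion.lean`, on top of `…TelescopingRecursion.lean`,
`…ScaleInduction.lean` and their helper files).  This is a CONDITIONAL result: it does not close
the crux item.

Sources: H. Duminil-Copin, S. Smirnov, Ann. of Math. 175 (2012) (arXiv:1007.0575), Def. 1, §4;
the line card `Cruxes/DefectDecoherence/Lines/tip-martingale-depth-induction.md`.
-/

noncomputable section

open scoped BigOperators ComplexConjugate Classical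
open Literature.Probability.LatticeModels Literature.Probability.RandomPlanarGeometry.SAW

namespace Summit.CriticalPhenomena.SAWScalingLimit.Theorems.DefectDecoherence.TipMartingale

/-- `‖mid{v,t} - c_v‖ ≤ 1/2` for `t ∼ v` (it equals `1/(2√3)`). [folklore] -/
theorem norm_hexMidpoint_sub_hexCenter_le {v t : HexVertex} (h : hexGraph.Adj v t) :
    ‖hexMidpoint s(v, t) - hexCenter v‖ ≤ 1 / 2 := by
  have hmid : hexMidpoint s(v, t) - hexCenter v = (hexCenter t - hexCenter v) / 2 := by
    rw [hexMidpoint_mk]; ring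
  have hle : ‖hexCenter t - hexCenter v‖ ≤ 1 := by
    rw [← sq_le_one_iff₀ (norm_nonneg _), Complex.sq_norm, normSq_hexCenter_sub_of_adj h.symm]
    norm_num
  rw [hmid, norm_div, Complex.norm_two]
  linarith

/-- The crude bound `‖T(Λ,a,v)‖ ≤ M(Λ,a,v)/2` (triangle inequality, unimodular winding weights),
for every configuration. [folklore] -/
theorem crude_bound : CrudeBound (1 / 2) := by
  intro Λ u w v
  unfold defect mass
  rw [Finset.mul_sum]
  refine (norm_sum_le _ _).trans (Finset.sum_le_sum fun t ht => ?_)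
  have hadj : hexGraph.Adj v t := (Finset.mem_filter.1 ht).2
  have hxc : 0 ≤ xc := hexCriticalFugacity_pos_lt_one.1.le
  have h1 : ‖(starRingEnd ℂ) (hexMidpoint s(v, t) - hexCenter v)‖ ≤ 1 / 2 := by
    rw [RCLike.norm_conj]
    exact norm_hexMidpoint_sub_hexCenter_le hadj
  have h2 : ‖hexParafermionicObservable Λ s(u, w) xc (5 / 8) s(v, t)‖ ≤
      ‖hexParafermionicObservable Λ s(u, w) xc 0 s(v, t)‖ := by
    rw [hexParafermionicObservable_zero_spin, Complex.norm_real,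
      Real.norm_of_nonneg (Finset.sum_nonneg fun γ _ => pow_nonneg hxc _)]
    exact norm_hexParafermionicObservable_le _ _ hxc _ _
  rw [norm_mul]
  calc ‖(starRingEnd ℂ) (hexMidpoint s(v, t) - hexCenter v)‖ *
        ‖hexParafermionicObservable Λ s(u, w) xc (5 / 8) s(v, t)‖
      ≤ (1 / 2) * ‖hexParafermionicObservable Λ s(u, w) xc (5 / 8) s(v, t)‖ :=
        mul_le_mul_of_nonneg_right h1 (norm_nonneg _)
    _ ≤ (1 / 2) * ‖hexParafermionicObservable Λ s(u, w) xc 0 s(v, t)‖ :=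
        mul_le_mul_of_nonneg_left h2 (by norm_num)

/-- **REDUCTION OF THE CRUX (conditional result of the line `tip-martingale-depth-induction`).**
`DefectDecoherence` — `∃ C, θ > 3/4` with `‖T(Λ,a,v)‖ ≤ C R^{-θ} M(Λ,a,v)` for every simply
connected hexagonal domain, adjacent boundary root and `R`-deep vertex — follows from the two
scale-local exponent statements S1' (macroscopic orbit mixing at a rate `α > 3/4`) and S2 (wall
exit at an exponent `β > 3/4`); the proved parts are the crude bound, the telescoped first-entrance
recursion (S3') and the dyadic scale induction (S4'), giving `θ = (3/4 + min α β)/2`. [folklore] -/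
theorem defectDecoherence_of_orbitMixingMacro_of_wallExit :
    (∃ cα α : ℝ, 3 / 4 < α ∧ 0 ≤ cα ∧
      ∀ m₀ : ℝ, 1 ≤ m₀ → ∃ smin : ℝ, MixingBoundOn (fun m => cα * m ^ (-α)) m₀ smin) →
    (∃ c β : ℝ, 3 / 4 < β ∧ 0 ≤ c ∧ ExitBound c β) →
    Summit.CriticalPhenomena.SAWScalingLimit.Theses.SAWDefectDecoherence.DefectDecoherence := by
  rintro ⟨cα, α, hα, hcα, hmix⟩ ⟨c, β, hβ, hc, hexit⟩
  have hB : CrudeBound (1 / 2) := crude_bound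
  have hφ : ∀ m : ℝ, 1 ≤ m → 0 ≤ cα * m ^ (-α) := fun m hm =>
    mul_nonneg hcα (Real.rpow_nonneg (by linarith) _)
  have hstep : ∀ J : ℕ, ∃ smin : ℝ,
      RecursionStepOn DepthBound (fun m => cα * m ^ (-α)) c β (1 / 2) J smin :=
    stub_telescopingRecursionMacro (fun m => cα * m ^ (-α)) c β (1 / 2) hφ hc (by linarith)
      (by norm_num) hB hmix hexit
  have hbase : ∀ ρ : ℝ, 1 ≤ ρ → DepthBound ρ (1 / 2) := fun ρ _ Λ u w v _ => hB Λ u w v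
  obtain ⟨C, θ, hθ, hD⟩ := stub_scaleInductionMacro DepthBound cα α c β (1 / 2) depthBound_mono
    hα hβ hcα hc (by norm_num) hbase hstep
  refine ⟨C, θ, hθ, ?_⟩
  intro Λ hsc u w hadj hu hw v R hR hdeep
  exact hD R hR Λ u w v ⟨hsc, hadj, hu, hw, hR, hdeep⟩

/-- The original (wave-1) hypotheses also suffice: full-range orbit mixing `MixingBound (cα m^{-α})`
implies its macroscopic restriction. [folklore] -/
theorem defectDecoherence_of_orbitMixing_of_wallExit :
    (∃ cα α : ℝ, 3 / 4 < α ∧ 0 ≤ cα ∧ MixingBound (fun m => cα * m ^ (-α))) →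
    (∃ c β : ℝ, 3 / 4 < β ∧ 0 ≤ c ∧ ExitBound c β) →
    Summit.CriticalPhenomena.SAWScalingLimit.Theses.SAWDefectDecoherence.DefectDecoherence := by
  rintro ⟨cα, α, hα, hcα, hmix⟩ h2
  exact defectDecoherence_of_orbitMixingMacro_of_wallExit
    ⟨cα, α, hα, hcα, fun m₀ _ => ⟨0, hmix.on m₀ 0⟩⟩ h2

end Summit.CriticalPhenomena.SAWScalingLimit.Theorems.DefectDecoherence.TipMartingale

end
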